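import Summits.Ventures.CertifiedManyBodySolver.Observables.CanonicalCeilingW32K4o7SourcedRowG6o7
import HarnessLib

/-!
# CEILING SLOT 5 — the last untyped INFORMATIVE t′ = 0 lid under RULING 428's √2 rule: `Re ω(P₀^d) ≤ 1.3832267` @ h_tree 0.80812 (x line vs row 6/7, g = 4/7)

Cell hubbard-cq (rung CQ, CQ-TABLE canonical `t′ = 0` column, CEILING side; row «h-chord transport nodes», seat hubbard-cq-obsth-2 g23, 2026-08-29), on the
lead's CALL of cq STATUS 07:39:10Z (READ + CALL on anomaly-1 g32 ★ RESULT #8, `g32/ceil/ceil_census30.py` → `ceil_census30_post431.out` d5cdce60d3ea0b91): after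
CEILING SLOTS 3/4 (p705411 / p705923) exactly ONE untyped ELIGIBLE-by-precedent ceiling slot of the t′0 column is INFORMATIVE, i.e. strictly below the certificate-free
kinematic bound `√2 = 1.4142136` of `|Re ω(P₀^d)|` (RULING 428; typed by name in `Observables/LocalPairKinematicLid.lean`): the x-line slot at `g = 4/7` (anomaly scratch
`g32/slots/CeilSlot80812.lean` 23bf8ea4e3e24179). The lead asked for it bundled with this seat's next filing; no other ceiling-slot filing being planned in this lane, the
bundle has size one (separate small module; the parent `CanonicalCeilingW32K4o7SourcedRowG6o7.lean` sits at its size limit). Parent BY NAME: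
`canonicalCeiling_n7o8_tp0_W32k4o7x_of_row_g6o7` (p673017; valid `2/7 ≤ g < 6/7`; cap = W5 κ 4/7 two-field node `cert_sgf_openbox32x4_U8_mu7o4_k4o7_j264563_twoField` read UP
from `g₀ = 2/7` ⊕ x2dk `cert_capTPx2dk_4x3_U8_tpm1o4_g3o7_mu5o2`; anchor = the FLOOR cell's S1 row E15 @ g₂ = 6/7 `cert_pin1menuA0p_L3h0_U8_tp0_g6o7_E_j313009`). No new continuum,
no new node, zero compute:

* `canonicalCeiling_n7o8_tp0_W32k4o7x_decimal_g4o7_r6o7` — g = 4/7 (h_tree ≈ 0.80812): **Re ω(P₀^d) ≤ 1.3832267** (x ∈ (1.3832266513, 1.3832266515); numerator (A + B·g) − E15 =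
  +0.790490…; 97.8 % of √2 — informative by 0.0309869; booked floor at this field 0.4113594 (K4O7) ⇒ cell [0.4113594, 1.3832267] if the lead books it).

Word = `⌈10⁷·x⌉/10⁷`, `x = ((A + B·g) − E15)/(2·√2·(6/7 − g))` with the parent's typed ℚ literals PARSED FROM THE TREE, equal at both ends `√2 ∈ (1.4142135623, 1.4142135624)`;
calibration: the parent's own `_x_decimal_g1o2_r6o7` ↦ 1.2243003 and `_x_decimal_g3o7_r6o7` ↦ 1.1183494 reproduced; side condition of the slot rule exact and 7-dp TIGHT
(`1.3832266` violates it; anomaly's negative control rc 1). The ≥ √2 slots (t′0 1.6481040 @ 0.90914 · 2.1778586 @ 1.01015; A0 1.8769936 @ 0.80812 · 3.1653923 @ 0.90914)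
are NOT typed: vacuous by kinematics (RULING 428 / `SingletPair.abs_re_infVolExpect_localPairAt_dWave_le_sqrt_two`).

SIZE, STATED PLAINLY: kinematic scale; CONSISTENT WITH ANY RESPONSE SHAPE below it. HONEST FRAMING: a finite-field RESPONSE ceiling at a large pairing field (h_p = 4·h_tree) on
infinite-volume ground states at fixed density ⅞, CONDITIONAL by name on the κ 4/7 two-field node (W5-CERTIFIED), the x2dk g3o7 cap node (refereed) and the S1 row (dual
certificate replayed); a ceiling never speaks to presence; nothing about `h → 0`; never onset, gap, `T_c` or order; superconductivity in the Hubbard model is NOT proved or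
disproved by any of this. No definition; no named fact; no `sorry`. References: R. B. Griffiths, Phys. Rev. 152 (1966) 240 §II; T. Koma, H. Tasaki, J. Stat. Phys. 76 (1994) 745 §1.
-/

noncomputable section

namespace Summit.Ventures.CertifiedManyBodySolver.Observables

open Matrix Finset Literature.Probability.LatticeModels
open Literature.MathematicalPhysics.QuantumLattice Literature.MathematicalPhysics.QuantumLattice.ThermodynamicLimit
open Literature.MathematicalPhysics.QuantumLattice.TwoCluster InfVolFermionState
open Summit.Ventures.CertifiedManyBodySolver Summit.Ventures.CertifiedManyBodySolver.Certificates
open scoped ComplexOrder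

section CeilSlot5

variable {ω : InfVolFermionState 2}

/-- `1.4142135623 < √2`. [folklore] -/
private theorem sqrt_two_gt_14142135623_s5 : (14142135623 / 10 ^ 10 : ℝ) < Real.sqrt 2 := by
  rw [Real.lt_sqrt (by norm_num)]; norm_num

/-- Slot rule for a ceiling (verbatim the parent's private rule): from `x ≤ N/(2(√2·g₂ − √2·g))` with `g < g₂`, `0 ≤ N` and the decidable side
condition `N·10¹⁰ ≤ M·2·14142135623·(g₂ − g)` conclude `x ≤ M`. [folklore] -/
private theorem chord_le_of_decimal_bound_s5 {x N g g₂ M : ℝ} (hgg : g < g₂) (hN : 0 ≤ N)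
    (hside : N * 10 ^ 10 ≤ M * (2 * 14142135623 * (g₂ - g))) (hx : x ≤ N / (2 * (Real.sqrt 2 * g₂ - Real.sqrt 2 * g))) : x ≤ M := by
  have hs := sqrt_two_gt_14142135623_s5
  have hδ : 0 < g₂ - g := sub_pos.2 hgg
  have hden : 0 < 2 * (Real.sqrt 2 * g₂ - Real.sqrt 2 * g) := by
    have : Real.sqrt 2 * g₂ - Real.sqrt 2 * g = Real.sqrt 2 * (g₂ - g) := by ring
    rw [this]; positivity
  refine hx.trans ?_
  rw [div_le_iff₀ hden]
  have hM : 0 ≤ M := by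
    by_contra hM'
    have : M * (2 * 14142135623 * (g₂ - g)) < 0 := mul_neg_of_neg_of_pos (not_le.mp hM') (by positivity)
    nlinarith
  nlinarith [mul_le_mul_of_nonneg_left hs.le (by positivity : (0:ℝ) ≤ M * (2 * (g₂ - g)))]

/-- **Ceiling slot at `g = 4/7` (`h_tree ≈ 0.80812`), t′ = 0, x line (κ 4/7 two-field node `cert_sgf_openbox32x4_U8_mu7o4_k4o7_j264563_twoField` read UP
from g₀ = 2/7 ⊕ x2dk `cert_capTPx2dk_4x3_U8_tpm1o4_g3o7_mu5o2`) vs the FLOOR cell's S1 row E15 @ g₂ = 6/7 (`cert_pin1menuA0p_L3h0_U8_tp0_g6o7_E_j313009`):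
`Re ω(P₀^d) ≤ 1.3832267`** for every translation-invariant density-`7/8` minimiser of `E_{√2·4/7}` (exact chord `1.3832266514…`, 7 dp UP, decidable through
`1.4142135623 < √2`; the last untyped INFORMATIVE lid of the column: 97.8 % of the kinematic bound √2; booked floor at this field 0.4113594). Instance of
`canonicalCeiling_n7o8_tp0_W32k4o7x_of_row_g6o7`. CONDITIONAL by name on the three nodes. Kinematic scale; a ceiling never speaks to presence. [cite: Griffiths1966, §II] -/
theorem canonicalCeiling_n7o8_tp0_W32k4o7x_decimal_g4o7_r6o7 (hω : ω.IsTranslationInvariant) (hρ : ω.density = 7 / 8)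
    (hmin : ∀ ω' : InfVolFermionState 2, ω'.IsTranslationInvariant → ω'.density = 7 / 8 →
      ω.meanEnergy (hubbardTTPrimeSourcedInteraction 1 0 8 0 dWaveFormFactor (Real.sqrt 2 * (4 / 7 : ℝ))) 1 ≤
        ω'.meanEnergy (hubbardTTPrimeSourcedInteraction 1 0 8 0 dWaveFormFactor (Real.sqrt 2 * (4 / 7 : ℝ))) 1)
    (hW : cert_sgf_openbox32x4_U8_mu7o4_k4o7_j264563_twoField) (hC : cert_capTPx2dk_4x3_U8_tpm1o4_g3o7_mu5o2) (hN : cert_pin1menuA0p_L3h0_U8_tp0_g6o7_E_j313009) :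
    (ω.expect (pairRegion (insert (0 : Site 2) unitSteps) 0) (localPairAt (insert 0 unitSteps) dWaveFormFactor 0)).re ≤ (13832267 / 10000000 : ℝ) :=
  chord_le_of_decimal_bound_s5 (by norm_num) (by push_cast; norm_num) (by push_cast; norm_num)
    (canonicalCeiling_n7o8_tp0_W32k4o7x_of_row_g6o7 (4 / 7 : ℝ) (by norm_num) ⟨by norm_num, by norm_num⟩ hω hρ hmin hW hC hN)

end CeilSlot5

end Summit.Ventures.CertifiedManyBodySolver.Observables

end
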